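import Summits.BirchSwinnertonDyer.BirchSwinnertonDyer.Theorems.ResidualThetaTransportAtTwoSignedMuVanishingAtTwoPlusOldClassDilation
import HarnessLib

/-!
# Route `ResidualThetaTransportAtTwo`, crux Kμ⁺ `SignedMuVanishingAtTwoPlus` (stmt-BirchSwinnertonDyer-20689),
# line `birth`, stub `stub_flatMuZeroAtTwo`: the MOD-2 TRANSPORT LEMMA — a non-zero sum of odd dilates of a
# `T₂`-distribution on the `2`-power cusps cannot kill the even layers unless the distribution itself does

Cell `bsd-wall`, width seat `bsd-wall-rtt-p4-w2` (g3). THEOREMS ONLY (no `def`, no named fact, no `sorry`); pure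
`Mathlib` over `…OldClassDilation` (Lemma A); helper `--supports` the crux. BSD is not proved by this.

For the habitat⁺ newform `f = f_W` (level `N = N_W` odd, `a₂ = 0`) FLAT at `(W, f)` is «some doubled plus symbol
`2([b/4^k]⁺_f − [0]⁺_f)`, `k ≥ 1`, `b` odd, is ODD» (w3 p592461 / lead g5 p593268). The companion file
`…OldClassFlat` shows that this property DESCENDS along a mod-2 congruence of plus symbols
`2([x]⁺_f − [0]⁺_f) ≡ ∑_{t ∈ S} 2([t x]⁺_g − [0]⁺_g) (mod 2)` (`S` a finite set of odd `t`, e.g. the divisors of `N/N₀`;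
`g` a newform of level `N₀ ∣ N` with `a₂(g)` even — the shape forced by mod-2 multiplicity one, Buzzard 2000 Prop. 2.4,
see the crux workfile `CuspSpanIhara.md`) to the SAME property of `g`. The mechanism is the present file, a statement
about functions on odd residues only (the mod-2 shadow of the «unit content of Euler factors» of
Emerton–Pollack–Weston 2006, Lemma 4.4.4, in the `±`/even-layer setting at `p = 2`):

`eq_zero_of_sum_dilations_eq_zero` — let `F_k : ℤ → 𝔽₂` (`k ≥ 1`; think `F_k(b) = 2([b/4^k]⁺ − [0]⁺) mod 2`) be
`4^k`-periodic and even, satisfying the `T₂`-DISTRIBUTION RELATIONS `F_k(b) + F_{k+1}(b) + F_{k+1}(b + 2^{2k+1}) = ε`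
(`k ≥ 1`, `b` odd) and `F_1(b) + F_1(b + 2) = ε` (these are `a₂[x]⁺ = [x/2]⁺ + [(x+1)/2]⁺ + [2x]⁺` at `x = b/2^{2k+1}`
resp. `x = b/2` for `a₂` even, `ε = 2([1/2]⁺ − [0]⁺) mod 2`). If `∑_{t∈S} F_k(t b) = 0` for all `k ≥ 1`, `b` odd
(`S ≠ ∅` finite, odd), then `F_k(b) = 0` for all `k ≥ 1`, `b` odd. Proof: Lemma A at level `n = 2k + 2 ≫ 0` gives
`F_{k+1}(b + 2^{2k+1}) = F_{k+1}(b)`, so the distribution relation reads `F_k ≡ ε` for `k ≫ 0`; downward induction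
gives `F_k ≡ ε` for all `k ≥ 1`; then `ε + ε = ε`, `ε = 0`.

References: M. Emerton, R. Pollack, T. Weston, Invent. Math. 163 (2006) Lemma 4.4.4, Prop. 4.4.5 [EmertonPollackWeston2006];
B. Mazur, J. Tate, J. Teitelbaum, Invent. Math. 84 (1986) §I.4 (4.2), §I.13 [MazurTateTeitelbaum1986Invent];
K. Buzzard, Math. Res. Lett. 7 (2000) Prop. 2.4 [Buzzard2000].
-/


set_option autoImplicit false
set_option linter.dupNamespace false

noncomputable section

open scoped Classical
open Polynomial

namespace Summit.BirchSwinnertonDyer.BirchSwinnertonDyer.Theorems.SignedMuAtTwo.OldClassTransport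

/-! ## §4. The transport lemma for `T₂`-distributions on the `2`-power cusps -/

section Transport

/-- A `c`-periodic function takes equal values at arguments congruent modulo `c`. [folklore] -/
theorem eq_of_periodic_of_intCast_eq {F : ℤ → ZMod 2} {c : ℕ} (hF : Function.Periodic F (c : ℤ)) {x y : ℤ}
    (h : (x : ZMod c) = (y : ZMod c)) : F x = F y := by
  rw [ZMod.intCast_eq_intCast_iff_dvd_sub] at h
  obtain ⟨q, hq⟩ := h
  have : y = x + q * (c : ℤ) := by linarith
  rw [this]
  exact (hF.int_mul q x).symm

/-- **THE TRANSPORT LEMMA (mod-2 unit content of old-class Euler factors on the even Mazur–Tate layers).**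
Let `F_k : ℤ → 𝔽₂` (`k ∈ ℕ`; only `k ≥ 1` matters) be `4^k`-periodic and even, and satisfy the `T₂`-distribution
relations `F_k(b) + F_{k+1}(b) + F_{k+1}(b + 2^{2k+1}) = ε` for `k ≥ 1`, `b` odd, and `F_1(b) + F_1(b+2) = ε` for `b`
odd. Let `S ≠ ∅` be a finite set of odd naturals with `∑_{t∈S} F_k(t b) = 0` for all `k ≥ 1` and all odd `b`. Then
`F_k(b) = 0` for all `k ≥ 1` and all odd `b`. (Applied in `…OldClassFlat` to `F_k(b) = 2([b/4^k]⁺_g − [0]⁺_g) mod 2`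
for a newform `g` with `a₂(g)` even: an old class `∑_t χ_g(A_t · A_t⁻¹)` kills the even `2`-power cusp loops only if
`χ_g` does.) Proof: Lemma A at level `2k+2 ≫ 0` makes `F_{k+1}(b + 2^{2k+1}) = F_{k+1}(b)`, so `F_k ≡ ε` for `k ≫ 0`;
downward induction along the distribution relation gives `F_k ≡ ε` for all `k ≥ 1`; then `ε + ε = ε`.
[cite: EmertonPollackWeston2006, Lemma 4.4.4 and Prop. 4.4.5 (unit content of Euler factors; mod-2 even-layer shadow)] [cite: MazurTateTeitelbaum1986Invent, §I.4 (4.2)] -/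
theorem eq_zero_of_sum_dilations_eq_zero (F : ℕ → ℤ → ZMod 2) (ε : ZMod 2)
    (hper : ∀ k, Function.Periodic (F k) ((4 : ℤ) ^ k))
    (heven : ∀ k (b : ℤ), F k (-b) = F k b)
    (hdist : ∀ k, 1 ≤ k → ∀ b : ℤ, Odd b → F k b + F (k + 1) b + F (k + 1) (b + 2 ^ (2 * k + 1)) = ε)
    (hdist0 : ∀ b : ℤ, Odd b → F 1 b + F 1 (b + 2) = ε)
    (S : Finset ℕ) (hS : S.Nonempty) (hodd : ∀ t ∈ S, Odd t)
    (hkill : ∀ k, 1 ≤ k → ∀ b : ℤ, Odd b → ∑ t ∈ S, F k (t * b) = 0) :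
    ∀ k, 1 ≤ k → ∀ b : ℤ, Odd b → F k b = 0 := by
  have h22 : ∀ x y : ZMod 2, x + y + y = x := by decide
  -- Step 1: for `k ≥ K₀ := max S + 1`, `F_{k+1}(b + 2^{2k+1}) = F_{k+1}(b)` for odd `b`.
  set K₀ : ℕ := S.sup id + 1 with hK₀
  have hSlt : ∀ t ∈ S, t < 2 ^ (2 * K₀) := by
    intro t ht
    have h1 : t ≤ S.sup id := Finset.le_sup (f := id) ht
    have h2 : S.sup id + 1 < 2 ^ (S.sup id + 1) := Nat.lt_two_pow_self
    calc t < 2 ^ (S.sup id + 1) := by omega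
      _ ≤ 2 ^ (2 * K₀) := Nat.pow_le_pow_right (by norm_num) (by omega)
  have step1 : ∀ k, K₀ ≤ k → ∀ b : ℤ, Odd b → F (k + 1) (b + 2 ^ (2 * k + 1)) = F (k + 1) b := by
    intro k hk b hb
    -- level `n = 2k + 2`
    set n : ℕ := 2 * k + 2 with hn
    have hn3 : 3 ≤ n := by omega
    haveI : NeZero (2 ^ n) := ⟨pow_ne_zero n two_ne_zero⟩
    have h4n : ((4 : ℤ) ^ (k + 1)) = ((2 ^ n : ℕ) : ℤ) := by
      rw [hn, show 2 * k + 2 = 2 * (k + 1) by ring, pow_mul]; push_cast; norm_num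
    have hperZ : Function.Periodic (F (k + 1)) ((2 ^ n : ℕ) : ℤ) := h4n ▸ hper (k + 1)
    have hcongr : ∀ x y : ℤ, (x : ZMod (2 ^ n)) = (y : ZMod (2 ^ n)) → F (k + 1) x = F (k + 1) y :=
      fun x y h ↦ eq_of_periodic_of_intCast_eq hperZ h
    -- odd naturals are units modulo `2^n`
    have hcop : ∀ t : ℕ, Odd t → Nat.Coprime t (2 ^ n) := fun t ht ↦
      Nat.Coprime.pow_right n ((Nat.Prime.coprime_iff_not_dvd Nat.prime_two).mpr ht.not_two_dvd_nat).symm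
    -- the units `τ t`
    let τ : ℕ → (ZMod (2 ^ n))ˣ := fun t ↦
      if h : Nat.Coprime t (2 ^ n) then ZMod.unitOfCoprime t h else 1
    have hτ : ∀ t ∈ S, (τ t : ZMod (2 ^ n)) = (t : ZMod (2 ^ n)) := by
      intro t ht
      simp only [τ, dif_pos (hcop t (hodd t ht)), ZMod.coe_unitOfCoprime]
    -- the unit `w = 1 + 2^(n-1)`
    have hwcop : Nat.Coprime (1 + 2 ^ (n - 1)) (2 ^ n) := by
      refine hcop _ ?_
      have : Even (2 ^ (n - 1)) := Nat.even_pow.mpr ⟨even_two, by omega⟩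
      obtain ⟨c, hc⟩ := this
      exact ⟨c, by omega⟩
    set w : (ZMod (2 ^ n))ˣ := ZMod.unitOfCoprime (1 + 2 ^ (n - 1)) hwcop with hwdef
    have hw : (w : ZMod (2 ^ n)) = 1 + 2 ^ (n - 1) := by rw [hwdef, ZMod.coe_unitOfCoprime]; push_cast; rfl
    -- the even function `Φ`
    set Φ : (ZMod (2 ^ n))ˣ → ZMod 2 := fun u ↦ F (k + 1) (((u : ZMod (2 ^ n)).val : ℕ) : ℤ) with hΦdef
    have hΦx : ∀ (u : (ZMod (2 ^ n))ˣ) (x : ℤ), (x : ZMod (2 ^ n)) = (u : ZMod (2 ^ n)) →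
        Φ u = F (k + 1) x := by
      intro u x hx
      apply hcongr
      rw [hx, Int.cast_natCast, ZMod.natCast_zmod_val]
    have hevenΦ : ∀ u, Φ (-u) = Φ u := by
      intro u
      rw [hΦx (-u) (-((((u : ZMod (2 ^ n)).val : ℕ) : ℤ))) (by
        push_cast; rw [ZMod.natCast_zmod_val]), heven]
    have hkillΦ : ∀ u, ∑ t ∈ S, Φ (τ t * u) = 0 := by
      intro u
      have hvodd : Odd ((((u : ZMod (2 ^ n)).val : ℕ) : ℤ)) := by
        rw [Int.odd_coe_nat]
        have hc : Nat.Coprime ((u : ZMod (2 ^ n)).val) 2 :=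
          Nat.Coprime.coprime_dvd_right (dvd_pow_self 2 (by omega)) (ZMod.val_coe_unit_coprime u)
        exact Nat.Coprime.odd_of_right hc
      rw [← hkill (k + 1) (by omega) _ hvodd]
      refine Finset.sum_congr rfl fun t ht ↦ hΦx _ _ ?_
      push_cast
      rw [hτ t ht, ZMod.natCast_zmod_val]
    -- distinctness of the `τ t` modulo `2^(n-1)`
    have hn1 : n - 1 = 2 * k + 1 := by omega
    have htlt : ∀ t ∈ S, t < 2 ^ (2 * k) := fun t ht ↦
      lt_of_lt_of_le (hSlt t ht) (Nat.pow_le_pow_right (by norm_num) (by omega))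
    have hdistτ : ∀ t ∈ S, ∀ t' ∈ S, t ≠ t' →
        ZMod.castHom (two_pow_sub_one_dvd n) (ZMod (2 ^ (n - 1))) (τ t : ZMod (2 ^ n)) ≠
          ZMod.castHom (two_pow_sub_one_dvd n) (ZMod (2 ^ (n - 1))) (τ t' : ZMod (2 ^ n)) ∧
        ZMod.castHom (two_pow_sub_one_dvd n) (ZMod (2 ^ (n - 1))) (τ t : ZMod (2 ^ n)) ≠
          - ZMod.castHom (two_pow_sub_one_dvd n) (ZMod (2 ^ (n - 1))) (τ t' : ZMod (2 ^ n)) := by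
      intro t ht t' ht' hne
      have hM : 2 ^ (2 * k) * 2 = 2 ^ (n - 1) := by rw [hn1, pow_succ]
      have h1 := htlt t ht
      have h2 := htlt t' ht'
      rw [hτ t ht, hτ t' ht', map_natCast, map_natCast]
      constructor
      · intro h
        rw [ZMod.natCast_eq_natCast_iff'] at h
        rw [Nat.mod_eq_of_lt (by omega), Nat.mod_eq_of_lt (by omega)] at h
        exact hne h
      · intro h
        have h3 : ((t + t' : ℕ) : ZMod (2 ^ (n - 1))) = 0 := by push_cast; rw [h, neg_add_cancel]
        rw [ZMod.natCast_eq_zero_iff] at h3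
        have h4 : 0 < t + t' := by have := (hodd t ht).pos; omega
        have h5 := Nat.le_of_dvd h4 h3
        omega
    -- Lemma A
    have hA := apply_mul_eq_of_sum_dilations_eq_zero hn3 S hS τ hdistτ Φ hevenΦ hkillΦ w hw
    -- read it at `b`
    have hnat : ∀ d : ℕ, Odd d → F (k + 1) ((1 + 2 ^ (n - 1)) * (d : ℤ)) = F (k + 1) d := by
      intro d hd
      have hu := hA (ZMod.unitOfCoprime d (hcop d hd))
      rw [hΦx _ ((1 + 2 ^ (n - 1)) * (d : ℤ)) (by rw [Units.val_mul, hw, ZMod.coe_unitOfCoprime]; push_cast; ring),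
        hΦx _ (d : ℤ) (by rw [ZMod.coe_unitOfCoprime]; push_cast; rfl)] at hu
      exact hu
    have hall : F (k + 1) ((1 + 2 ^ (n - 1)) * b) = F (k + 1) b := by
      have hd : Odd b.natAbs := Int.natAbs_odd.mpr hb
      rcases Int.natAbs_eq b with hb0 | hb0
      · rw [hb0]; exact hnat _ hd
      · rw [hb0, mul_neg, heven, heven]; exact hnat _ hd
    rw [← hn1, ← hall]
    apply hcongr
    rw [ZMod.intCast_eq_intCast_iff_dvd_sub]
    obtain ⟨c, hc⟩ := hb
    refine ⟨c, ?_⟩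
    rw [hc, show ((2 ^ n : ℕ) : ℤ) = 2 ^ (n - 1) * 2 by rw [← pow_succ, show n - 1 + 1 = n by omega]; push_cast; rfl]
    ring
  -- Step 2: `F k ≡ ε` on odd arguments for `k ≥ K₀`
  have step2 : ∀ k, K₀ ≤ k → 1 ≤ k → ∀ b : ℤ, Odd b → F k b = ε := by
    intro k hk hk1 b hb
    have h := hdist k hk1 b hb
    rw [step1 k hk b hb, h22] at h
    exact h
  -- Step 3: downward induction
  have step3 : ∀ d j : ℕ, 1 ≤ j → K₀ ≤ j + d → ∀ b : ℤ, Odd b → F j b = ε := by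
    intro d
    induction d with
    | zero => intro j hj hjd; exact step2 j (by omega) hj
    | succ d ih =>
      intro j hj hjd b hb
      by_cases hjK : K₀ ≤ j
      · exact step2 j hjK hj b hb
      · have hb' : Odd (b + 2 ^ (2 * j + 1)) := hb.add_even (Int.even_pow.mpr ⟨even_two, by omega⟩)
        have h := hdist j hj b hb
        rw [ih (j + 1) (by omega) (by omega) b hb, ih (j + 1) (by omega) (by omega) _ hb', h22] at h
        exact h
  -- Step 4: `ε = 0`
  have hε : ε = 0 := by
    have h := hdist0 1 odd_one
    rw [step3 K₀ 1 le_rfl (by omega) 1 odd_one, step3 K₀ 1 le_rfl (by omega) _ (by decide)] at h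
    have : ∀ x : ZMod 2, x + x = x → x = 0 := by decide
    exact this ε h
  intro k hk b hb
  rw [step3 K₀ k hk (by omega) b hb, hε]

end Transport

end Summit.BirchSwinnertonDyer.BirchSwinnertonDyer.Theorems.SignedMuAtTwo.OldClassTransport

end
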